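import Literature.Computability.AlgebraicComplexity.MatMulBorderRankCertificate
import HarnessLib

/-!
# `bR(⟨4,4,4⟩) ≤ 46` (Smirnov 2014): the explicit approximate algorithm with 46 multiplications, kernel-checked

Topic `Literature/Computability/AlgebraicComplexity`; sibling of `BorderRankMatMulThreeSmirnov.lean`
(`bR(⟨3,3,3⟩) ≤ 20`) and `BorderRankMatMul244Smirnov.lean` (same toolkit), and the upper companion
of the `4 × 4` lower-bound files (`twentyeight_le_algBorderRank_matMulTensor_four`,
Landsberg–Michałek's `29 ≤ R̲(M_⟨4⟩)` as a named fact).  THIS FILE PROVES `bR(⟨4,4,4⟩) ≤ 46` over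
every commutative ring by a kernel-checked certificate: Smirnov's approximate (APA) bilinear algorithm
of length `46` for the product of two `4 × 4` matrices — A. V. Smirnov, *The approximate bilinear
algorithm of length 46 for multiplication of 4 × 4 matrices*, arXiv:1412.1687 (2014): "We propose the
arbitrary precision approximate (APA) bilinear algorithm of length 46 for multiplication of 4 x 4 and
4 x 4 matrices. The algorithm has polynomial order 3 and 352 nonzero coefficients from total 2208"
(abstract, p. 1; the algorithm is printed on pp. 2–7; p. 7: "All coefficients except binomial … are
monomials. All coefficients of polynomials are in {-1, 1}").  For comparison, the exact rank record is
`R(⟨4,4,4⟩) ≤ 48` (kernel certificate `MatMulFourRank48Proofs.lean`) and `49 = 7²` by Strassen.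

## The data and where they come from

`46` triples `αᵗ, βᵗ, γᵗ ∈ ℤ[x,x⁻¹]^{4×4}` (on `A`, `B`, `C = AB`), entries Laurent monomials in
`{0, ±1, ±x, ±x², ±x⁻¹}` and the binomial `x + x²`, with
`∑ₜ αᵗ_{ij} βᵗ_{j'l} γᵗ_{i'l'} = δ_{ii'} δ_{jj'} δ_{ll'} + O(x)` (352 nonzero coefficients, as printed).
The coefficients are those of the machine-readable transcription distributed with Benson–Ballard's
*fast-matmul* framework (PPoPP 2015; file `codegen/algorithms/smirnov444-46-352-approx`, "Smirnov's
APA algorithm for rank 46 4x4x4; error params: sigma = 1, phi = 3").  Clearing poles per product (and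
completing the `C`-column to total order `3`) gives polynomial vectors `Uₜ, Vₜ, Wₜ` over `ℤ` (degrees
`≤ 3`) with `∑ₜ Uₜ ⊗ Vₜ ⊗ Wₜ = x³ · ⟨4,4,4⟩ + O(x⁴)` — an order-`3` approximate decomposition with `46`
triads (Bläser Def. 6.1; "polynomial order 3" as printed).  Confirmed in exact rational and in integer
arithmetic before transcription; the transcription route is not trusted: the kernel check IS the proof.

* `Smirnov2014.M444.cU / cV / cW` — the data (product-major, flat row-major slots of `matMulFlat 4 4 4`);
* `Smirnov2014.M444.row_0 … row_15`, `check` — `ApproxCert.check 16 16 16 46 3 1 (matMulFlat 4 4 4) …`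
  by `decide +kernel`, one `C`-coordinate at a time;
* `Smirnov2014_approxRank_three_matMulTensor_four_le` (`R₃(⟨4,4,4⟩) ≤ 46`),
  `Smirnov2014_algBorderRank_matMulTensor_four_le` (`bR(⟨4,4,4⟩) ≤ 46`, every commutative ring).

## References

* [Smirnov2014APA444] A. V. Smirnov, *The approximate bilinear algorithm of length 46 for
  multiplication of 4 × 4 matrices*, arXiv:1412.1687 (2014) — abstract (length 46, polynomial order 3,
  352 nonzero coefficients), pp. 2–7 (the algorithm), p. 7 (discussion).
* [BensonBallard2015] A. R. Benson, G. Ballard, *A framework for practical parallel fast matrix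
  multiplication*, PPoPP 2015, doi:10.1145/2688500.2688513 — software `fast-matmul`, file
  `codegen/algorithms/smirnov444-46-352-approx` (the coefficients used here).
* [Blaser2013] M. Bläser, *Fast Matrix Multiplication*, Theory of Computing Graduate Surveys 5 (2013)
  — Def. 6.1, Thm. 6.3(1).
-/

noncomputable section

open scoped BigOperators

namespace Literature.Computability.AlgebraicComplexity

namespace Smirnov2014.M444

/-! ## The data: `46` triads of polynomial vectors over `ℤ` (product-major; entry = ascending coefficient list) -/

/-- `Uₜ ∈ ℤ[ε]^{4×4}` (`t = 1, …, 46`): the vectors on the product slot `C = AB` (flat row-major position `l + 4·i` of the entry `(i,l)`), as ascending coefficient lists. [cite: Smirnov2014APA444, pp. 2–7 (the algorithm; abstract: length 46, polynomial order 3, 352 nonzero coefficients)] [cite: BensonBallard2015, file codegen/algorithms/smirnov444-46-352-approx] -/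
def cU : List (List (List ℤ)) :=
  [[[], [], [0, 1], [], [0, 0, 1], [], [], [], [], [], [], [], [], [], [], []],
   [[], [], [], [], [], [0, 0, 1], [], [], [], [], [], [1], [], [0, 0, -1], [], []],
   [[], [], [], [], [], [], [], [], [], [-1], [], [], [], [0, 0, 1], [1], []],
   [[], [], [], [], [], [], [], [], [], [], [], [-1], [], [0, 0, 1], [], []],
   [[], [], [], [], [], [], [], [], [], [], [], [1], [], [], [], [0, 0, -1]],
   [[], [], [], [], [], [], [0, 0, 1], [1], [], [], [], [], [], [], [], []],
   [[], [], [], [], [], [1], [], [], [], [], [], [], [], [], [1], []],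
   [[], [], [0, 0, 1], [1], [0, 0, 0, 1], [], [], [], [-1], [], [], [], [], [], [], []],
   [[], [0, 0, 1], [], [], [], [], [], [], [0, 1], [0, 0, -1], [], [-1], [], [0, 0, 1], [], []],
   [[], [], [], [], [], [], [], [], [], [], [], [], [], [], [], [0, 1]],
   [[], [], [0, 1], [], [0, 0, 1], [], [], [], [1], [], [], [], [], [], [], []],
   [[], [], [], [], [], [], [], [], [], [0, 1], [], [], [], [], [], [0, 1]],
   [[1], [], [], [], [], [], [], [], [], [], [], [], [0, -1], [], [], []],
   [[], [], [], [1], [0, 0, -1], [0, 0, 1], [], [1], [], [], [], [1], [], [0, 0, -1], [], []],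
   [[], [], [], [], [], [], [], [1], [], [], [], [], [], [], [], []],
   [[], [0, 0, 1], [], [], [], [], [], [], [0, 1], [], [], [], [], [], [], []],
   [[], [], [0, -1], [], [], [], [0, 0, 0, 1], [], [], [], [], [], [], [], [], []],
   [[], [], [], [], [], [0, 1], [], [], [], [], [], [], [], [], [], [0, -1]],
   [[], [], [], [], [0, -1], [], [], [], [], [], [1], [], [], [], [], []],
   [[], [], [], [-1], [0, 0, 1], [], [], [], [], [], [], [], [], [], [], []],
   [[], [], [], [], [], [], [], [], [], [], [], [-1], [], [], [0, 0, 1], []],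
   [[], [], [], [], [], [-1], [], [], [], [], [], [], [1], [0, 0, 0, 1], [], []],
   [[], [], [], [], [0, 1], [], [], [], [], [], [], [], [], [], [], []],
   [[], [], [0, 1], [], [], [], [], [], [], [], [], [], [], [], [], []],
   [[], [], [], [], [], [], [], [], [], [], [], [1], [], [], [], []],
   [[1], [], [], [], [], [], [], [], [], [], [], [], [], [], [], []],
   [[], [1], [], [], [], [], [], [], [], [], [], [], [], [], [], []],
   [[], [0, 1], [], [], [], [], [], [], [], [], [], [], [], [0, 0, 0, 1], [], [0, 1]],
   [[], [], [], [], [], [], [], [], [], [1], [], [], [1], [], [], []],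
   [[], [], [], [0, 1], [], [], [], [], [], [], [], [], [0, 1], [], [], []],
   [[], [0, 0, 0, 1], [], [], [], [], [], [], [], [], [], [], [1], [], [], []],
   [[], [], [], [], [], [], [], [], [1], [], [], [], [], [], [], []],
   [[], [], [], [], [0, 1], [], [0, 0, 0, -1], [], [], [], [], [], [], [], [], []],
   [[], [], [], [1], [], [], [], [], [], [], [], [], [], [], [], []],
   [[], [], [], [], [], [], [], [], [], [1], [], [], [], [], [], []],
   [[], [], [], [], [], [], [], [1], [], [], [-1], [], [], [], [], []],
   [[], [], [], [], [], [], [], [], [], [], [], [], [], [], [1], []],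
   [[], [], [], [], [], [1], [], [], [], [], [], [], [], [], [], []],
   [[], [], [0, 0, 0, 1], [], [0, -1], [], [], [], [0, 0, 1], [], [1], [-1], [], [], [0, 0, 1], []],
   [[], [], [], [], [], [], [], [], [], [], [], [], [1], [], [], []],
   [[], [], [], [], [], [], [], [], [], [], [1], [], [], [], [], []],
   [[], [], [], [], [], [], [0, 0, 0, 1], [], [], [], [1], [], [], [], [], []],
   [[1], [], [], [], [], [], [], [], [1], [], [], [], [], [], [], []],
   [[], [-1], [], [], [], [], [], [], [], [], [], [], [], [], [1], []],
   [[0, 0, 0, 1], [], [], [1], [], [], [], [], [], [], [], [], [], [], [], []],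
   [[], [], [0, -1], [], [], [], [0, 0, 1, 1], [1], [], [], [], [], [], [], [], []]]

/-- `Vₜ ∈ ℤ[ε]^{4×4}`: the vectors on the left-factor slot `A` (flat position `j + 4·i` of `(i,j)`). [cite: Smirnov2014APA444, pp. 2–7 (the algorithm; abstract: length 46, polynomial order 3, 352 nonzero coefficients)] [cite: BensonBallard2015, file codegen/algorithms/smirnov444-46-352-approx] -/
def cV : List (List (List ℤ)) :=
  [[[0, 0, 1], [0, 0, 1], [0, 0, -1], [1], [], [1], [], [], [], [], [], [], [], [], [], []],
   [[], [], [], [], [], [], [0, 1], [1], [], [], [0, 0, -1], [], [], [], [], []],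
   [[], [], [], [], [], [], [], [], [0, 0, 0, -1], [], [], [0, 0, -1], [], [], [], [1]],
   [[], [], [], [], [], [], [0, 1], [1], [], [], [0, 0, -1], [1], [0, -1], [], [], [1]],
   [[], [], [], [], [], [], [], [], [0, 0, 0, 1], [], [0, 0, 1], [], [0, -1], [], [], [1]],
   [[], [], [], [], [0, 0, 0, 1], [1], [0, 1], [], [], [], [0, 0, 0, 1], [], [], [], [], []],
   [[], [], [], [], [0, 0, 0, 1], [], [0, 0, 0, 1], [0, 0, 1], [], [], [], [], [], [1], [], []],
   [[], [], [], [1], [], [], [], [], [], [], [0, 0, 0, 1], [], [], [], [], []],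
   [[], [], [], [], [], [], [], [], [], [], [], [1], [], [], [], []],
   [[], [], [0, 0, 1], [0, 0, 1], [], [], [0, 0, -1], [], [], [], [0, 0, 1], [], [], [1], [1], [1]],
   [[], [], [], [-1], [], [], [], [], [], [0, 0, 1], [], [], [], [], [], []],
   [[], [], [], [], [], [], [], [], [], [], [0, 0, 1], [], [], [], [], [1]],
   [[], [1], [], [], [], [], [], [], [], [], [], [], [0, 0, 1], [], [], []],
   [[], [], [], [], [], [], [0, 1], [1], [], [], [], [], [], [], [], []],
   [[], [], [], [], [0, 0, 0, 1], [], [0, 1], [1], [], [], [], [], [], [], [], []],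
   [[], [], [], [1], [], [], [], [], [], [], [], [1], [], [], [], []],
   [[], [], [0, 0, -1], [], [], [1], [], [], [], [], [], [], [], [], [], []],
   [[], [], [], [], [], [], [0, 0, 1], [], [], [], [], [], [], [-1], [], []],
   [[], [], [], [], [], [], [], [-1], [0, 0, 0, 1], [1], [], [], [], [], [], []],
   [[0, 0, 0, 1], [], [], [], [], [], [0, 1], [1], [], [], [], [], [], [], [], []],
   [[], [], [], [], [], [], [], [], [], [1], [], [], [0, 1], [], [], [-1]],
   [[], [], [], [], [], [0, 0, 0, -1], [], [], [], [], [], [], [], [1], [], []],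
   [[], [], [], [], [1], [0, -1], [], [-1], [0, 0, 0, 1], [], [], [], [], [], [], []],
   [[], [0, 0, -1], [0, 0, 1], [], [], [-1], [], [], [], [], [], [], [], [], [], []],
   [[], [], [], [], [], [], [], [], [], [], [], [], [0, 1], [], [], [-1]],
   [[0, 0, 0, 1], [1], [], [-1], [], [], [], [], [0, 0, 0, -1], [], [], [], [0, 0, 1], [], [], []],
   [[0, 0, 0, 1], [], [], [0, 0, 1], [], [], [], [], [], [], [], [], [], [], [1], []],
   [[], [], [0, 0, 1], [0, 0, 1], [], [], [], [], [], [], [], [], [], [], [1], []],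
   [[], [], [], [], [], [], [], [], [], [0, 0, 0, 1], [], [], [], [], [], [1]],
   [[], [-1], [], [], [], [], [], [], [], [], [], [], [], [], [0, 0, 1], []],
   [[], [1], [], [], [], [], [], [], [], [], [], [], [], [], [], []],
   [[], [], [], [1], [], [], [], [], [], [], [], [], [], [], [], []],
   [[], [], [], [], [1], [], [], [], [], [], [], [], [], [], [], []],
   [[0, 0, 0, 1], [0, 1], [-1], [1], [], [], [0, 1], [1], [], [], [0, 0, 0, 1], [], [], [], [0, 0, 0, -1], []],
   [[], [], [], [], [], [], [], [], [], [], [], [], [], [], [], [-1]],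
   [[], [], [], [], [], [], [], [1], [], [], [0, 0, 0, -1], [], [], [], [], []],
   [[], [], [], [], [0, 0, 0, 1], [], [0, 0, 0, 1], [0, 0, 1], [0, 0, 0, -1], [], [], [0, 0, -1], [], [1], [1], [1]],
   [[], [], [], [], [], [], [], [], [], [], [], [], [], [1], [], []],
   [[], [], [], [], [], [], [], [], [], [-1], [], [], [], [], [], []],
   [[], [1], [], [], [], [0, 0, 0, -1], [], [], [], [0, 0, 0, 1], [], [], [], [1], [], [1]],
   [[], [], [], [], [], [], [], [1], [], [], [], [], [], [], [], []],
   [[], [], [], [], [], [], [], [1], [], [], [], [0, 0, 0, 1], [], [], [], []],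
   [[], [], [], [1], [], [], [], [], [0, 0, 0, 1], [], [], [], [], [], [], []],
   [[], [], [], [], [], [], [], [], [], [], [], [], [], [], [1], []],
   [[], [], [1], [], [], [], [], [], [], [], [], [], [], [], [], []],
   [[], [], [], [], [], [-1], [], [], [], [], [], [], [], [], [], []]]

/-- `Wₜ ∈ ℤ[ε]^{4×4}`: the vectors on the right-factor slot `B` (flat position `l + 4·j` of `(j,l)`). [cite: Smirnov2014APA444, pp. 2–7 (the algorithm; abstract: length 46, polynomial order 3, 352 nonzero coefficients)] [cite: BensonBallard2015, file codegen/algorithms/smirnov444-46-352-approx] -/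
def cW : List (List (List ℤ)) :=
  [[[], [], [1], [], [0, 1], [], [], [], [0, 1], [], [], [], [], [], [0, 0, 1], []],
   [[], [-1], [], [1], [], [], [], [], [], [], [], [], [], [0, 1], [], []],
   [[], [1], [0, 0, 1], [], [], [], [], [], [], [], [], [], [], [], [0, 0, 0, 1], []],
   [[], [-1], [], [], [], [], [], [], [], [], [], [], [], [0, 1], [], []],
   [[], [], [], [1], [], [], [], [], [], [], [], [0, 1], [], [], [], []],
   [[], [], [], [], [], [], [], [0, 0, 0, 1], [], [], [1], [], [], [], [], []],
   [[], [1], [], [], [], [], [0, 0, 0, 1], [], [], [], [], [], [], [], [], []],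
   [[], [], [], [], [], [], [], [], [-1], [], [], [], [], [], [], [0, 0, 0, 1]],
   [[], [1], [], [], [], [], [], [], [], [], [], [], [], [0, -1], [], [0, 0, 0, -1]],
   [[], [], [], [], [], [], [], [], [], [-1], [], [0, 0, 1], [], [], [], []],
   [[], [], [1], [], [0, 1], [], [], [], [], [], [], [], [], [], [], []],
   [[], [], [], [0, 1], [], [], [], [], [], [1], [], [], [], [], [], [0, 0, 1]],
   [[-1], [], [], [], [0, 0, 0, 1], [], [], [], [], [], [], [], [0, 0, 0, 1], [], [], []],
   [[], [], [], [-1], [], [], [], [], [], [], [], [], [], [], [], []],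
   [[], [], [], [1], [], [], [], [], [], [], [-1], [0, 0, 1], [], [], [], [0, 0, 0, 1]],
   [[], [-1], [], [], [], [], [], [], [], [], [], [], [0, 0, 1], [0, 1], [], []],
   [[], [], [], [], [], [], [1], [], [0, 1], [], [1], [], [], [], [], []],
   [[], [], [], [], [], [], [], [0, 0, 1], [], [1], [], [0, 0, -1], [], [], [], []],
   [[], [], [1], [], [], [], [0, 0, 0, 1], [], [], [], [], [], [], [], [], []],
   [[], [], [], [-1], [], [], [], [], [1], [], [], [], [], [], [], []],
   [[], [], [1], [], [], [], [], [0, 0, 0, -1], [], [], [], [], [], [], [], []],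
   [[], [], [], [], [0, 0, 0, 1], [1], [], [], [], [], [], [], [], [], [], []],
   [[], [], [1], [], [], [], [], [], [0, 1], [], [], [], [0, 0, -1], [], [], []],
   [[], [], [1], [], [0, 1], [], [-1], [], [], [], [], [], [], [], [0, 0, 1], []],
   [[], [1], [1], [1], [], [], [], [0, 0, 0, -1], [], [], [], [0, 1], [], [0, -1], [], []],
   [[1], [], [], [], [], [], [], [], [], [], [], [], [0, 0, 0, -1], [], [], []],
   [[], [1], [], [], [], [], [], [], [], [0, -1], [0, 0, 0, 1], [], [], [], [], []],
   [[], [], [], [], [], [], [], [], [], [1], [], [], [], [], [], []],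
   [[], [], [], [], [], [1], [], [], [], [], [], [], [0, 0, 0, 1], [], [], []],
   [[], [], [], [], [], [], [], [0, 0, -1], [1], [], [], [], [], [], [], []],
   [[0, -1], [], [], [], [], [1], [], [0, 0, 0, -1], [0, 1], [], [], [], [], [], [], []],
   [[-1], [0, 1], [1], [], [0, 1], [], [], [], [-1], [], [], [], [0, 0, 0, -1], [0, 0, -1], [], [0, 0, 0, 1]],
   [[0, 0, 1], [], [-1], [], [], [], [], [], [0, -1], [], [], [], [0, 0, 1], [], [], []],
   [[], [], [], [], [], [], [], [], [1], [], [], [], [], [], [], []],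
   [[], [-1], [0, 0, -1], [0, 0, 1], [], [1], [], [], [], [0, 1], [], [], [0, 0, 0, 1], [], [0, 0, 0, -1], [0, 0, 0, 1]],
   [[], [], [], [], [], [], [], [], [], [], [1], [0, 0, -1], [], [], [], []],
   [[], [-1], [], [], [], [], [], [], [], [], [], [], [], [], [], []],
   [[], [-1], [], [], [0, 0, 0, 1], [1], [0, 0, 0, -1], [0, 0, 0, 1], [], [0, 1], [], [0, 0, 0, -1], [], [], [], []],
   [[], [], [1], [], [], [], [], [], [], [], [], [], [], [], [], []],
   [[], [], [], [], [], [-1], [], [], [], [], [], [], [], [], [], []],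
   [[], [], [1], [], [], [], [0, 0, 0, 1], [], [], [], [1], [0, 0, -1], [], [], [-1], []],
   [[], [], [], [], [], [], [], [], [], [], [], [], [], [], [1], []],
   [[1], [], [], [], [], [], [], [], [], [], [], [], [], [], [], []],
   [[], [1], [], [], [], [], [], [], [], [], [0, 0, 0, 1], [], [], [], [], []],
   [[], [], [], [], [], [], [], [], [1], [], [], [0, 0, 0, 1], [], [], [], []],
   [[], [], [], [], [], [], [], [], [], [], [1], [], [], [], [], []]]

/-! ## The finite check, one kernel evaluation per `C`-coordinate (`ApproxCert.checkRow`) -/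

/-- Row `0` of the certificate check (entries `(0, j, l)`, degrees `0, …, 3`). [cite: Smirnov2014APA444, abstract and pp. 2–7] -/
theorem row_0 : ApproxCert.checkRow 16 16 16 46 3 1 (matMulFlat 4 4 4) (ptab cU) (ptab cV) (ptab cW) ⟨0, by decide⟩ = true := by
  decide +kernel

/-- Row `1` of the certificate check (entries `(1, j, l)`, degrees `0, …, 3`). [cite: Smirnov2014APA444, abstract and pp. 2–7] -/
theorem row_1 : ApproxCert.checkRow 16 16 16 46 3 1 (matMulFlat 4 4 4) (ptab cU) (ptab cV) (ptab cW) ⟨1, by decide⟩ = true := by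
  decide +kernel

/-- Row `2` of the certificate check (entries `(2, j, l)`, degrees `0, …, 3`). [cite: Smirnov2014APA444, abstract and pp. 2–7] -/
theorem row_2 : ApproxCert.checkRow 16 16 16 46 3 1 (matMulFlat 4 4 4) (ptab cU) (ptab cV) (ptab cW) ⟨2, by decide⟩ = true := by
  decide +kernel

/-- Row `3` of the certificate check (entries `(3, j, l)`, degrees `0, …, 3`). [cite: Smirnov2014APA444, abstract and pp. 2–7] -/
theorem row_3 : ApproxCert.checkRow 16 16 16 46 3 1 (matMulFlat 4 4 4) (ptab cU) (ptab cV) (ptab cW) ⟨3, by decide⟩ = true := by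
  decide +kernel

/-- Row `4` of the certificate check (entries `(4, j, l)`, degrees `0, …, 3`). [cite: Smirnov2014APA444, abstract and pp. 2–7] -/
theorem row_4 : ApproxCert.checkRow 16 16 16 46 3 1 (matMulFlat 4 4 4) (ptab cU) (ptab cV) (ptab cW) ⟨4, by decide⟩ = true := by
  decide +kernel

/-- Row `5` of the certificate check (entries `(5, j, l)`, degrees `0, …, 3`). [cite: Smirnov2014APA444, abstract and pp. 2–7] -/
theorem row_5 : ApproxCert.checkRow 16 16 16 46 3 1 (matMulFlat 4 4 4) (ptab cU) (ptab cV) (ptab cW) ⟨5, by decide⟩ = true := by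
  decide +kernel

/-- Row `6` of the certificate check (entries `(6, j, l)`, degrees `0, …, 3`). [cite: Smirnov2014APA444, abstract and pp. 2–7] -/
theorem row_6 : ApproxCert.checkRow 16 16 16 46 3 1 (matMulFlat 4 4 4) (ptab cU) (ptab cV) (ptab cW) ⟨6, by decide⟩ = true := by
  decide +kernel

/-- Row `7` of the certificate check (entries `(7, j, l)`, degrees `0, …, 3`). [cite: Smirnov2014APA444, abstract and pp. 2–7] -/
theorem row_7 : ApproxCert.checkRow 16 16 16 46 3 1 (matMulFlat 4 4 4) (ptab cU) (ptab cV) (ptab cW) ⟨7, by decide⟩ = true := by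
  decide +kernel

/-- Row `8` of the certificate check (entries `(8, j, l)`, degrees `0, …, 3`). [cite: Smirnov2014APA444, abstract and pp. 2–7] -/
theorem row_8 : ApproxCert.checkRow 16 16 16 46 3 1 (matMulFlat 4 4 4) (ptab cU) (ptab cV) (ptab cW) ⟨8, by decide⟩ = true := by
  decide +kernel

/-- Row `9` of the certificate check (entries `(9, j, l)`, degrees `0, …, 3`). [cite: Smirnov2014APA444, abstract and pp. 2–7] -/
theorem row_9 : ApproxCert.checkRow 16 16 16 46 3 1 (matMulFlat 4 4 4) (ptab cU) (ptab cV) (ptab cW) ⟨9, by decide⟩ = true := by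
  decide +kernel

/-- Row `10` of the certificate check (entries `(10, j, l)`, degrees `0, …, 3`). [cite: Smirnov2014APA444, abstract and pp. 2–7] -/
theorem row_10 : ApproxCert.checkRow 16 16 16 46 3 1 (matMulFlat 4 4 4) (ptab cU) (ptab cV) (ptab cW) ⟨10, by decide⟩ = true := by
  decide +kernel

/-- Row `11` of the certificate check (entries `(11, j, l)`, degrees `0, …, 3`). [cite: Smirnov2014APA444, abstract and pp. 2–7] -/
theorem row_11 : ApproxCert.checkRow 16 16 16 46 3 1 (matMulFlat 4 4 4) (ptab cU) (ptab cV) (ptab cW) ⟨11, by decide⟩ = true := by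
  decide +kernel

/-- Row `12` of the certificate check (entries `(12, j, l)`, degrees `0, …, 3`). [cite: Smirnov2014APA444, abstract and pp. 2–7] -/
theorem row_12 : ApproxCert.checkRow 16 16 16 46 3 1 (matMulFlat 4 4 4) (ptab cU) (ptab cV) (ptab cW) ⟨12, by decide⟩ = true := by
  decide +kernel

/-- Row `13` of the certificate check (entries `(13, j, l)`, degrees `0, …, 3`). [cite: Smirnov2014APA444, abstract and pp. 2–7] -/
theorem row_13 : ApproxCert.checkRow 16 16 16 46 3 1 (matMulFlat 4 4 4) (ptab cU) (ptab cV) (ptab cW) ⟨13, by decide⟩ = true := by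
  decide +kernel

/-- Row `14` of the certificate check (entries `(14, j, l)`, degrees `0, …, 3`). [cite: Smirnov2014APA444, abstract and pp. 2–7] -/
theorem row_14 : ApproxCert.checkRow 16 16 16 46 3 1 (matMulFlat 4 4 4) (ptab cU) (ptab cV) (ptab cW) ⟨14, by decide⟩ = true := by
  decide +kernel

/-- Row `15` of the certificate check (entries `(15, j, l)`, degrees `0, …, 3`). [cite: Smirnov2014APA444, abstract and pp. 2–7] -/
theorem row_15 : ApproxCert.checkRow 16 16 16 46 3 1 (matMulFlat 4 4 4) (ptab cU) (ptab cV) (ptab cW) ⟨15, by decide⟩ = true := by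
  decide +kernel

/-- **The whole certificate checks**: `∑ₜ Uₜ ⊗ Vₜ ⊗ Wₜ = ε^3 · ⟨4,4,4⟩ + O(ε^4)` (flat format). [cite: Smirnov2014APA444, abstract and pp. 2–7] -/
theorem check : ApproxCert.check 16 16 16 46 3 1 (matMulFlat 4 4 4) (ptab cU) (ptab cV) (ptab cW) = true :=
  ApproxCert.check_of_forall_checkRow fun i => by
    fin_cases i
    exacts [row_0, row_1, row_2, row_3, row_4, row_5, row_6, row_7, row_8, row_9, row_10, row_11, row_12, row_13, row_14, row_15]

end Smirnov2014.M444


/-! ## The bounds -/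

section Bounds

variable (K : Type*) [CommRing K]

/-- **`R₃(⟨4,4,4⟩) ≤ 46`** over every commutative ring (order-`3` approximate rank; "polynomial order
3" as printed): Smirnov's approximate algorithm of length 46. [cite: Smirnov2014APA444, abstract and
pp. 2–7] [cite: BensonBallard2015, file codegen/algorithms/smirnov444-46-352-approx] -/
theorem Smirnov2014_approxRank_three_matMulTensor_four_le :
    approxRank 3 (matMulTensor K 4 4 4) ≤ 46 :=
  approxRank_matMulTensor_le_of_check K Smirnov2014.M444.check (by simp)

/-- **`bR(⟨4,4,4⟩) ≤ 46`**, over every commutative ring. [cite: Smirnov2014APA444, abstract and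
pp. 2–7] -/
theorem Smirnov2014_algBorderRank_matMulTensor_four_le :
    algBorderRank (matMulTensor K 4 4 4) ≤ 46 :=
  algBorderRank_matMulTensor_le_of_check K Smirnov2014.M444.check (by simp)

end Bounds

end Literature.Computability.AlgebraicComplexity

end
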